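import Summits.Ventures.PercRepro.S1CoreLPColoopStep
import Summits.Ventures.PercRepro.S1CellSevenFiveAll
import Summits.Ventures.PercRepro.S1CellSevenSixAllB
import Summits.Ventures.PercRepro.S1CellSevenSevenAll
import Summits.Ventures.PercRepro.S1CellSevenEightAll
import Summits.Ventures.PercRepro.S1CellSevenNineAll
import Summits.Ventures.PercRepro.S1CellEightFiveAll
import Summits.Ventures.PercRepro.S1CellEightSixAll
import Summits.Ventures.PercRepro.S1CellEightSevenAll
import Summits.Ventures.PercRepro.S1CellEightEightAll
import Summits.Ventures.PercRepro.S1CellEightNineAll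
import Summits.Ventures.PercRepro.S1CellNineFiveAll
import Summits.Ventures.PercRepro.S1CellNineSixAll
import Summits.Ventures.PercRepro.S1CellNineSevenAll
import Summits.Ventures.PercRepro.S1CellNineEightAll
import Summits.Ventures.PercRepro.S1CellNineNineAll

/-!
# PercRepro — THE FIFTEEN CELLS `(p, d)`, `7 ≤ p ≤ 9`, `5 ≤ d ≤ 9`, WITH COLOOPS ALLOWED (p2, gen 29; SUBCLAIM-S1
§6.10 (xviii))

Every finite matroid of rank `p ∈ {7, 8, 9}` on `p + d` points (`5 ≤ d ≤ 9`) with all pairs of rank `2` and every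
line of at most `3` points satisfies the `(p, 4)` body: without coloops by the coloop/closure LP of the cell
(`S1Cell<p><d>All`), with a coloop `e` by the coloop step `rls_succ_of_isColoop` applied to `M ∖ e` — the cell
`(p − 1, d)` of the same corank, down to the diagonal `(6, 4)` (`SixFour.rls_six_four_holds`). Nothing is claimed
about any cell beyond these fifteen.

* `rls_<p>_four_of_<n>_all` for the fifteen `(p, d)`.
Axioms: standard.
-/

open scoped Matroid

namespace PercRepro

namespace S1

open Set

variable {α : Type}

/-- **THE `(7, 5)` CELL WITH COLOOPS ALLOWED**: every finite matroid of rank `7` on `12` points with all pairs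
of rank `2` and lines of at most `3` points satisfies `ThmN.RLS M 7 4`. -/
theorem rls_seven_four_of_twelve_all (M : Matroid α) [M.Finite] (hM : M.eRank = ((7 : ℕ) : ℕ∞))
    (hE : M.E.ncard = 12) (hpairs : ∀ e ∈ M.E, ∀ f ∈ M.E, e ≠ f → M.eRk {e, f} = 2)
    (_hlines : ∀ L ⊆ M.E, M.eRk L = 2 → L.ncard ≤ 3) : ThmN.RLS M 7 4 := by
  by_cases hcol : M.coloops = ∅
  · exact rls_seven_four_of_twelve M hM hE hcol hpairs
  · obtain ⟨e, he⟩ := nonempty_iff_ne_empty.mpr hcol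
    have he' : M.IsColoop e := he
    have heE : e ∈ M.E := he'.mem_ground
    have hE' : (M ＼ {e}).E.ncard = 11 := by
      have := ncard_ground_delete_singleton M heE
      omega
    exact rls_succ_of_isColoop M he' (r := 6) hM (by norm_num) phiK_seven_le
      (SixFour.rls_six_four_holds (M ＼ {e}))

/-- **THE `(8, 5)` CELL WITH COLOOPS ALLOWED**: every finite matroid of rank `8` on `13` points with all pairs
of rank `2` and lines of at most `3` points satisfies `ThmN.RLS M 8 4`. -/
theorem rls_eight_four_of_thirteen_all (M : Matroid α) [M.Finite] (hM : M.eRank = ((8 : ℕ) : ℕ∞))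
    (hE : M.E.ncard = 13) (hpairs : ∀ e ∈ M.E, ∀ f ∈ M.E, e ≠ f → M.eRk {e, f} = 2)
    (hlines : ∀ L ⊆ M.E, M.eRk L = 2 → L.ncard ≤ 3) : ThmN.RLS M 8 4 := by
  by_cases hcol : M.coloops = ∅
  · exact rls_eight_four_of_thirteen M hM hE hcol hpairs
  · obtain ⟨e, he⟩ := nonempty_iff_ne_empty.mpr hcol
    have he' : M.IsColoop e := he
    have heE : e ∈ M.E := he'.mem_ground
    have hE' : (M ＼ {e}).E.ncard = 12 := by
      have := ncard_ground_delete_singleton M heE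
      omega
    exact rls_succ_of_isColoop M he' (r := 7) hM (by norm_num) phiK_eight_le
      (rls_seven_four_of_twelve_all (M ＼ {e}) (Matroid.eRank_delete_eq he' hM) hE' (pairs_delete_singleton M e hpairs) (lines_delete_singleton M e hlines))

/-- **THE `(9, 5)` CELL WITH COLOOPS ALLOWED**: every finite matroid of rank `9` on `14` points with all pairs
of rank `2` and lines of at most `3` points satisfies `ThmN.RLS M 9 4`. -/
theorem rls_nine_four_of_fourteen_all (M : Matroid α) [M.Finite] (hM : M.eRank = ((9 : ℕ) : ℕ∞))
    (hE : M.E.ncard = 14) (hpairs : ∀ e ∈ M.E, ∀ f ∈ M.E, e ≠ f → M.eRk {e, f} = 2)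
    (hlines : ∀ L ⊆ M.E, M.eRk L = 2 → L.ncard ≤ 3) : ThmN.RLS M 9 4 := by
  by_cases hcol : M.coloops = ∅
  · exact rls_nine_four_of_fourteen M hM hE hcol hpairs
  · obtain ⟨e, he⟩ := nonempty_iff_ne_empty.mpr hcol
    have he' : M.IsColoop e := he
    have heE : e ∈ M.E := he'.mem_ground
    have hE' : (M ＼ {e}).E.ncard = 13 := by
      have := ncard_ground_delete_singleton M heE
      omega
    exact rls_succ_of_isColoop M he' (r := 8) hM (by norm_num) phiK_nine_le
      (rls_eight_four_of_thirteen_all (M ＼ {e}) (Matroid.eRank_delete_eq he' hM) hE' (pairs_delete_singleton M e hpairs) (lines_delete_singleton M e hlines))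

/-- **THE `(7, 6)` CELL WITH COLOOPS ALLOWED**: every finite matroid of rank `7` on `13` points with all pairs
of rank `2` and lines of at most `3` points satisfies `ThmN.RLS M 7 4`. -/
theorem rls_seven_four_of_thirteen_all (M : Matroid α) [M.Finite] (hM : M.eRank = ((7 : ℕ) : ℕ∞))
    (hE : M.E.ncard = 13) (hpairs : ∀ e ∈ M.E, ∀ f ∈ M.E, e ≠ f → M.eRk {e, f} = 2)
    (hlines : ∀ L ⊆ M.E, M.eRk L = 2 → L.ncard ≤ 3) : ThmN.RLS M 7 4 := by
  by_cases hcol : M.coloops = ∅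
  · exact rls_seven_four_of_thirteen_of_lines_b M hM hE hcol hpairs hlines
  · obtain ⟨e, he⟩ := nonempty_iff_ne_empty.mpr hcol
    have he' : M.IsColoop e := he
    have heE : e ∈ M.E := he'.mem_ground
    have hE' : (M ＼ {e}).E.ncard = 12 := by
      have := ncard_ground_delete_singleton M heE
      omega
    exact rls_succ_of_isColoop M he' (r := 6) hM (by norm_num) phiK_seven_le
      (SixFour.rls_six_four_holds (M ＼ {e}))

/-- **THE `(8, 6)` CELL WITH COLOOPS ALLOWED**: every finite matroid of rank `8` on `14` points with all pairs
of rank `2` and lines of at most `3` points satisfies `ThmN.RLS M 8 4`. -/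
theorem rls_eight_four_of_fourteen_all (M : Matroid α) [M.Finite] (hM : M.eRank = ((8 : ℕ) : ℕ∞))
    (hE : M.E.ncard = 14) (hpairs : ∀ e ∈ M.E, ∀ f ∈ M.E, e ≠ f → M.eRk {e, f} = 2)
    (hlines : ∀ L ⊆ M.E, M.eRk L = 2 → L.ncard ≤ 3) : ThmN.RLS M 8 4 := by
  by_cases hcol : M.coloops = ∅
  · exact rls_eight_four_of_fourteen_of_lines M hM hE hcol hpairs hlines
  · obtain ⟨e, he⟩ := nonempty_iff_ne_empty.mpr hcol
    have he' : M.IsColoop e := he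
    have heE : e ∈ M.E := he'.mem_ground
    have hE' : (M ＼ {e}).E.ncard = 13 := by
      have := ncard_ground_delete_singleton M heE
      omega
    exact rls_succ_of_isColoop M he' (r := 7) hM (by norm_num) phiK_eight_le
      (rls_seven_four_of_thirteen_all (M ＼ {e}) (Matroid.eRank_delete_eq he' hM) hE' (pairs_delete_singleton M e hpairs) (lines_delete_singleton M e hlines))

/-- **THE `(9, 6)` CELL WITH COLOOPS ALLOWED**: every finite matroid of rank `9` on `15` points with all pairs
of rank `2` and lines of at most `3` points satisfies `ThmN.RLS M 9 4`. -/
theorem rls_nine_four_of_fifteen_all (M : Matroid α) [M.Finite] (hM : M.eRank = ((9 : ℕ) : ℕ∞))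
    (hE : M.E.ncard = 15) (hpairs : ∀ e ∈ M.E, ∀ f ∈ M.E, e ≠ f → M.eRk {e, f} = 2)
    (hlines : ∀ L ⊆ M.E, M.eRk L = 2 → L.ncard ≤ 3) : ThmN.RLS M 9 4 := by
  by_cases hcol : M.coloops = ∅
  · exact rls_nine_four_of_fifteen_of_lines M hM hE hcol hpairs hlines
  · obtain ⟨e, he⟩ := nonempty_iff_ne_empty.mpr hcol
    have he' : M.IsColoop e := he
    have heE : e ∈ M.E := he'.mem_ground
    have hE' : (M ＼ {e}).E.ncard = 14 := by
      have := ncard_ground_delete_singleton M heE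
      omega
    exact rls_succ_of_isColoop M he' (r := 8) hM (by norm_num) phiK_nine_le
      (rls_eight_four_of_fourteen_all (M ＼ {e}) (Matroid.eRank_delete_eq he' hM) hE' (pairs_delete_singleton M e hpairs) (lines_delete_singleton M e hlines))

/-- **THE `(7, 7)` CELL WITH COLOOPS ALLOWED**: every finite matroid of rank `7` on `14` points with all pairs
of rank `2` and lines of at most `3` points satisfies `ThmN.RLS M 7 4`. -/
theorem rls_seven_four_of_fourteen_all (M : Matroid α) [M.Finite] (hM : M.eRank = ((7 : ℕ) : ℕ∞))
    (hE : M.E.ncard = 14) (hpairs : ∀ e ∈ M.E, ∀ f ∈ M.E, e ≠ f → M.eRk {e, f} = 2)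
    (hlines : ∀ L ⊆ M.E, M.eRk L = 2 → L.ncard ≤ 3) : ThmN.RLS M 7 4 := by
  by_cases hcol : M.coloops = ∅
  · exact rls_seven_four_of_fourteen_of_lines M hM hE hcol hpairs hlines
  · obtain ⟨e, he⟩ := nonempty_iff_ne_empty.mpr hcol
    have he' : M.IsColoop e := he
    have heE : e ∈ M.E := he'.mem_ground
    have hE' : (M ＼ {e}).E.ncard = 13 := by
      have := ncard_ground_delete_singleton M heE
      omega
    exact rls_succ_of_isColoop M he' (r := 6) hM (by norm_num) phiK_seven_le
      (SixFour.rls_six_four_holds (M ＼ {e}))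

/-- **THE `(8, 7)` CELL WITH COLOOPS ALLOWED**: every finite matroid of rank `8` on `15` points with all pairs
of rank `2` and lines of at most `3` points satisfies `ThmN.RLS M 8 4`. -/
theorem rls_eight_four_of_fifteen_all (M : Matroid α) [M.Finite] (hM : M.eRank = ((8 : ℕ) : ℕ∞))
    (hE : M.E.ncard = 15) (hpairs : ∀ e ∈ M.E, ∀ f ∈ M.E, e ≠ f → M.eRk {e, f} = 2)
    (hlines : ∀ L ⊆ M.E, M.eRk L = 2 → L.ncard ≤ 3) : ThmN.RLS M 8 4 := by
  by_cases hcol : M.coloops = ∅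
  · exact rls_eight_four_of_fifteen_of_lines M hM hE hcol hpairs hlines
  · obtain ⟨e, he⟩ := nonempty_iff_ne_empty.mpr hcol
    have he' : M.IsColoop e := he
    have heE : e ∈ M.E := he'.mem_ground
    have hE' : (M ＼ {e}).E.ncard = 14 := by
      have := ncard_ground_delete_singleton M heE
      omega
    exact rls_succ_of_isColoop M he' (r := 7) hM (by norm_num) phiK_eight_le
      (rls_seven_four_of_fourteen_all (M ＼ {e}) (Matroid.eRank_delete_eq he' hM) hE' (pairs_delete_singleton M e hpairs) (lines_delete_singleton M e hlines))

/-- **THE `(9, 7)` CELL WITH COLOOPS ALLOWED**: every finite matroid of rank `9` on `16` points with all pairs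
of rank `2` and lines of at most `3` points satisfies `ThmN.RLS M 9 4`. -/
theorem rls_nine_four_of_sixteen_all (M : Matroid α) [M.Finite] (hM : M.eRank = ((9 : ℕ) : ℕ∞))
    (hE : M.E.ncard = 16) (hpairs : ∀ e ∈ M.E, ∀ f ∈ M.E, e ≠ f → M.eRk {e, f} = 2)
    (hlines : ∀ L ⊆ M.E, M.eRk L = 2 → L.ncard ≤ 3) : ThmN.RLS M 9 4 := by
  by_cases hcol : M.coloops = ∅
  · exact rls_nine_four_of_sixteen_of_lines M hM hE hcol hpairs hlines
  · obtain ⟨e, he⟩ := nonempty_iff_ne_empty.mpr hcol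
    have he' : M.IsColoop e := he
    have heE : e ∈ M.E := he'.mem_ground
    have hE' : (M ＼ {e}).E.ncard = 15 := by
      have := ncard_ground_delete_singleton M heE
      omega
    exact rls_succ_of_isColoop M he' (r := 8) hM (by norm_num) phiK_nine_le
      (rls_eight_four_of_fifteen_all (M ＼ {e}) (Matroid.eRank_delete_eq he' hM) hE' (pairs_delete_singleton M e hpairs) (lines_delete_singleton M e hlines))

/-- **THE `(7, 8)` CELL WITH COLOOPS ALLOWED**: every finite matroid of rank `7` on `15` points with all pairs
of rank `2` and lines of at most `3` points satisfies `ThmN.RLS M 7 4`. -/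
theorem rls_seven_four_of_fifteen_all (M : Matroid α) [M.Finite] (hM : M.eRank = ((7 : ℕ) : ℕ∞))
    (hE : M.E.ncard = 15) (hpairs : ∀ e ∈ M.E, ∀ f ∈ M.E, e ≠ f → M.eRk {e, f} = 2)
    (hlines : ∀ L ⊆ M.E, M.eRk L = 2 → L.ncard ≤ 3) : ThmN.RLS M 7 4 := by
  by_cases hcol : M.coloops = ∅
  · exact rls_seven_four_of_fifteen_of_lines M hM hE hcol hpairs hlines
  · obtain ⟨e, he⟩ := nonempty_iff_ne_empty.mpr hcol
    have he' : M.IsColoop e := he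
    have heE : e ∈ M.E := he'.mem_ground
    have hE' : (M ＼ {e}).E.ncard = 14 := by
      have := ncard_ground_delete_singleton M heE
      omega
    exact rls_succ_of_isColoop M he' (r := 6) hM (by norm_num) phiK_seven_le
      (SixFour.rls_six_four_holds (M ＼ {e}))

/-- **THE `(8, 8)` CELL WITH COLOOPS ALLOWED**: every finite matroid of rank `8` on `16` points with all pairs
of rank `2` and lines of at most `3` points satisfies `ThmN.RLS M 8 4`. -/
theorem rls_eight_four_of_sixteen_all (M : Matroid α) [M.Finite] (hM : M.eRank = ((8 : ℕ) : ℕ∞))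
    (hE : M.E.ncard = 16) (hpairs : ∀ e ∈ M.E, ∀ f ∈ M.E, e ≠ f → M.eRk {e, f} = 2)
    (hlines : ∀ L ⊆ M.E, M.eRk L = 2 → L.ncard ≤ 3) : ThmN.RLS M 8 4 := by
  by_cases hcol : M.coloops = ∅
  · exact rls_eight_four_of_sixteen_of_lines M hM hE hcol hpairs hlines
  · obtain ⟨e, he⟩ := nonempty_iff_ne_empty.mpr hcol
    have he' : M.IsColoop e := he
    have heE : e ∈ M.E := he'.mem_ground
    have hE' : (M ＼ {e}).E.ncard = 15 := by
      have := ncard_ground_delete_singleton M heE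
      omega
    exact rls_succ_of_isColoop M he' (r := 7) hM (by norm_num) phiK_eight_le
      (rls_seven_four_of_fifteen_all (M ＼ {e}) (Matroid.eRank_delete_eq he' hM) hE' (pairs_delete_singleton M e hpairs) (lines_delete_singleton M e hlines))

/-- **THE `(9, 8)` CELL WITH COLOOPS ALLOWED**: every finite matroid of rank `9` on `17` points with all pairs
of rank `2` and lines of at most `3` points satisfies `ThmN.RLS M 9 4`. -/
theorem rls_nine_four_of_seventeen_all (M : Matroid α) [M.Finite] (hM : M.eRank = ((9 : ℕ) : ℕ∞))
    (hE : M.E.ncard = 17) (hpairs : ∀ e ∈ M.E, ∀ f ∈ M.E, e ≠ f → M.eRk {e, f} = 2)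
    (hlines : ∀ L ⊆ M.E, M.eRk L = 2 → L.ncard ≤ 3) : ThmN.RLS M 9 4 := by
  by_cases hcol : M.coloops = ∅
  · exact rls_nine_four_of_seventeen_of_lines M hM hE hcol hpairs hlines
  · obtain ⟨e, he⟩ := nonempty_iff_ne_empty.mpr hcol
    have he' : M.IsColoop e := he
    have heE : e ∈ M.E := he'.mem_ground
    have hE' : (M ＼ {e}).E.ncard = 16 := by
      have := ncard_ground_delete_singleton M heE
      omega
    exact rls_succ_of_isColoop M he' (r := 8) hM (by norm_num) phiK_nine_le
      (rls_eight_four_of_sixteen_all (M ＼ {e}) (Matroid.eRank_delete_eq he' hM) hE' (pairs_delete_singleton M e hpairs) (lines_delete_singleton M e hlines))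

/-- **THE `(7, 9)` CELL WITH COLOOPS ALLOWED**: every finite matroid of rank `7` on `16` points with all pairs
of rank `2` and lines of at most `3` points satisfies `ThmN.RLS M 7 4`. -/
theorem rls_seven_four_of_sixteen_all (M : Matroid α) [M.Finite] (hM : M.eRank = ((7 : ℕ) : ℕ∞))
    (hE : M.E.ncard = 16) (hpairs : ∀ e ∈ M.E, ∀ f ∈ M.E, e ≠ f → M.eRk {e, f} = 2)
    (hlines : ∀ L ⊆ M.E, M.eRk L = 2 → L.ncard ≤ 3) : ThmN.RLS M 7 4 := by
  by_cases hcol : M.coloops = ∅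
  · exact rls_seven_four_of_sixteen_of_lines M hM hE hcol hpairs hlines
  · obtain ⟨e, he⟩ := nonempty_iff_ne_empty.mpr hcol
    have he' : M.IsColoop e := he
    have heE : e ∈ M.E := he'.mem_ground
    have hE' : (M ＼ {e}).E.ncard = 15 := by
      have := ncard_ground_delete_singleton M heE
      omega
    exact rls_succ_of_isColoop M he' (r := 6) hM (by norm_num) phiK_seven_le
      (SixFour.rls_six_four_holds (M ＼ {e}))

/-- **THE `(8, 9)` CELL WITH COLOOPS ALLOWED**: every finite matroid of rank `8` on `17` points with all pairs
of rank `2` and lines of at most `3` points satisfies `ThmN.RLS M 8 4`. -/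
theorem rls_eight_four_of_seventeen_all (M : Matroid α) [M.Finite] (hM : M.eRank = ((8 : ℕ) : ℕ∞))
    (hE : M.E.ncard = 17) (hpairs : ∀ e ∈ M.E, ∀ f ∈ M.E, e ≠ f → M.eRk {e, f} = 2)
    (hlines : ∀ L ⊆ M.E, M.eRk L = 2 → L.ncard ≤ 3) : ThmN.RLS M 8 4 := by
  by_cases hcol : M.coloops = ∅
  · exact rls_eight_four_of_seventeen_of_lines M hM hE hcol hpairs hlines
  · obtain ⟨e, he⟩ := nonempty_iff_ne_empty.mpr hcol
    have he' : M.IsColoop e := he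
    have heE : e ∈ M.E := he'.mem_ground
    have hE' : (M ＼ {e}).E.ncard = 16 := by
      have := ncard_ground_delete_singleton M heE
      omega
    exact rls_succ_of_isColoop M he' (r := 7) hM (by norm_num) phiK_eight_le
      (rls_seven_four_of_sixteen_all (M ＼ {e}) (Matroid.eRank_delete_eq he' hM) hE' (pairs_delete_singleton M e hpairs) (lines_delete_singleton M e hlines))

/-- **THE `(9, 9)` CELL WITH COLOOPS ALLOWED**: every finite matroid of rank `9` on `18` points with all pairs
of rank `2` and lines of at most `3` points satisfies `ThmN.RLS M 9 4`. -/
theorem rls_nine_four_of_eighteen_all (M : Matroid α) [M.Finite] (hM : M.eRank = ((9 : ℕ) : ℕ∞))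
    (hE : M.E.ncard = 18) (hpairs : ∀ e ∈ M.E, ∀ f ∈ M.E, e ≠ f → M.eRk {e, f} = 2)
    (hlines : ∀ L ⊆ M.E, M.eRk L = 2 → L.ncard ≤ 3) : ThmN.RLS M 9 4 := by
  by_cases hcol : M.coloops = ∅
  · exact rls_nine_four_of_eighteen_of_lines M hM hE hcol hpairs hlines
  · obtain ⟨e, he⟩ := nonempty_iff_ne_empty.mpr hcol
    have he' : M.IsColoop e := he
    have heE : e ∈ M.E := he'.mem_ground
    have hE' : (M ＼ {e}).E.ncard = 17 := by
      have := ncard_ground_delete_singleton M heE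
      omega
    exact rls_succ_of_isColoop M he' (r := 8) hM (by norm_num) phiK_nine_le
      (rls_eight_four_of_seventeen_all (M ＼ {e}) (Matroid.eRank_delete_eq he' hM) hE' (pairs_delete_singleton M e hpairs) (lines_delete_singleton M e hlines))

end S1

end PercRepro
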